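import Mathlib
import Summits.Ventures.Crystal3D.Theorems.StickyWulffConstantTextureLiminfTentBilayerPrelude
import Summits.Ventures.Crystal3D.Theorems.StickyWulffConstantTextureLiminfTentPieces
import Literature.Analysis.Convexity.AnisotropicPerimeterPLCoarea
import Literature.Analysis.Convexity.AnisotropicPerimeterLevelSetsLocal
import Literature.Analysis.Convexity.FinitePerimeterTransform
import Literature.MathematicalPhysics.StatisticalMechanics.FccWulffBodyHull
import HarnessLib

/-!
# The tent certificate of one bilayer slab — LEVEL-PARAMETRISED form (lane T, brick (T0), stmt-Ventures-23912)

HONEST FRAMING. Venture `Summits/Ventures/Crystal3D` (cell `crystal3d-full`), route `route-Ventures-StickyWulffConstant`,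
helper `--supports` the law-v5 crux `TextureLiminfV5` (stmt-Ventures-23912), towards the registered stub
`stub_T0cover : BarlowFreeCertificateCover` of the lane-T skeleton `HOME/cf-p1/route/lines/tex/TexShadow.lean`
(finding F9: the Barlow tent needs ONE COMMON LEVEL across all bilayers so that layer-plane facets are covered).

`tent_bilayer_certificate` (`…TentBilayerCertificate.lean`) picks its generic level `t ∈ (0,1)` INSIDE the proof.  This
file proves the same certificate with the level choice EXPOSED (`tent_bilayer_certificate_level`): for every finite
site set `X` and every set `U` there are a measurable cost `F : ℝ → ℝ≥0∞` and a constant `C ≥ 0` with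
`4 C ≤ #IP + 2 #IL` (in-plane / inter-layer broken bonds of `X` near `U`) and `∫⁻_{(0,1)} F ≤ C`, such that for EVERY
level `t ∈ (0,1)` with `F t ≠ ⊤` (all but finitely many) the super-level pieces at level `t` — pairwise disjoint bounded
open polytopes with unit normals and distinct facet planes, inside the slab `S₀ = {0 < ⟪(1,1,1), √2 x⟫ < 2}`, of
finite perimeter, contained in `{f_X > t}` and exhausting `{f_X > t} ∩ S₀` up to a null set, within `√2` of the
occupied sites, carrying the slab-local mass clause — satisfy `∫_{⋃ pieces} div ξ ≤ (F t).toReal` for every admissible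
field supported in `U ∩ S₀`.  Summing the costs of the finitely many occupied bilayers of a grain and choosing ONE
`t` by `exists_mem_Ioo_le_of_lintegral_le` is done in the assembly file (`…TextureBuildTentCoverHolds.lean`).
The proof is the proof of `tent_bilayer_certificate` with the level abstracted; nothing else changes.
WHAT THIS IS NOT: the cover clause or the assembly; F-C1 not moved.
-/

noncomputable section

namespace Summit.Ventures.Crystal3D.TentCertificate

open Finset Summit.Ventures.Crystal3D MeasureTheory Literature.Analysis.Convexity
open Literature.Geometry.DiscreteGeometry (intVec intVec_apply)
open Literature.MathematicalPhysics.StatisticalMechanics (phiFcc phiFcc_nonneg phiFcc_neg fccWulffBody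
  isGreatest_inner_fccWulffBody fieldDivergence HasFinitePerimeter zero_mem_fccWulffBody isCompact_fccWulffBody)
open Summit.Ventures.Crystal3D.Cruxes.TextureLiminf.TexShadow (polytope)
open scoped RealInnerProductSpace ENNReal

/-! ## The certificate of one bilayer slab, level exposed -/

/-- **The tent certificate of one bilayer slab, in bilayer currency (cubic frame), LEVEL-PARAMETRISED.**
See the module docstring.  The slab is `S₀ = {x | 0 < ⟪(1,1,1), √2 x⟫ < 2}` (between the `(111)` layers `0`
and `1`); the cost `F` and the constant `C` do not depend on the level; every level `t ∈ (0,1)` off the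
finite bad set `{F = ⊤}` yields pieces with `∫ div ξ ≤ (F t).toReal`. -/
theorem tent_bilayer_certificate_level (X : Finset Site) (U : Set (EuclideanSpace ℝ (Fin 3))) :
    ∃ (F : ℝ → ℝ≥0∞) (C : ℝ), Measurable F ∧ 0 ≤ C ∧
      4 * C ≤ ((brokenNearIP X U).ncard : ℝ) + 2 * ((brokenNearIL X U).ncard : ℝ) ∧
      (∫⁻ t in Set.Ioo (0 : ℝ) 1, F t) ≤ ENNReal.ofReal C ∧
      ∀ t ∈ Set.Ioo (0 : ℝ) 1, F t ≠ ⊤ →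
        ∃ (J : ℕ) (Hd : Fin J → Finset (EuclideanSpace ℝ (Fin 3) × ℝ)),
          (∀ j, Bornology.IsBounded (polytope (Hd j))) ∧ (∀ j, ∀ p ∈ Hd j, ‖p.1‖ = 1) ∧
          (∀ j, ∀ p ∈ Hd j, ∀ p' ∈ Hd j, p ≠ p' →
            {x : EuclideanSpace ℝ (Fin 3) | ⟪p.1, x⟫ = p.2} ≠ {x | ⟪p'.1, x⟫ = p'.2}) ∧
          (∀ j j', j ≠ j' → Disjoint (polytope (Hd j)) (polytope (Hd j'))) ∧
          (∀ j, polytope (Hd j) ⊆ {x | 0 < ⟪intVec (normal4 0), Real.sqrt 2 • x⟫ ∧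
            ⟪intVec (normal4 0), Real.sqrt 2 • x⟫ < 2}) ∧
          (∀ j, HasFinitePerimeter (polytope (Hd j))) ∧
          (⋃ j, polytope (Hd j)) ⊆ {x | t < tent X x} ∧
          volume (({x | t < tent X x} ∩ {x | 0 < ⟪intVec (normal4 0), Real.sqrt 2 • x⟫ ∧
              ⟪intVec (normal4 0), Real.sqrt 2 • x⟫ < 2}) \ ⋃ j, polytope (Hd j)) = 0 ∧
          (⋃ j, polytope (Hd j)) ⊆ (⋃ a ∈ X, Metric.closedBall (site a) (Real.sqrt 2)) ∧
          volume ({y : EuclideanSpace ℝ (Fin 3) | (0 < ⟪intVec (normal4 0), Real.sqrt 2 • y⟫ ∧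
              ⟪intVec (normal4 0), Real.sqrt 2 • y⟫ < 2) ∧
              ∀ a : Site, (lay a = 0 ∨ lay a = 1) → dist y (site a) ≤ Real.sqrt 2 → a ∈ X} \
            ⋃ j, polytope (Hd j)) = 0 ∧
          ∀ ξ : EuclideanSpace ℝ (Fin 3) → EuclideanSpace ℝ (Fin 3), ContDiff ℝ 1 ξ → HasCompactSupport ξ →
            (∀ z, ξ z ∈ fccWulffBody) →
            tsupport ξ ⊆ U ∩ {x | 0 < ⟪intVec (normal4 0), Real.sqrt 2 • x⟫ ∧
              ⟪intVec (normal4 0), Real.sqrt 2 • x⟫ < 2} →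
            ∫ z in ⋃ j, polytope (Hd j), fieldDivergence ξ z ≤ (F t).toReal := by
  classical
  -- enumerate the complex
  set L := labelsOf X with hL
  set N := L.card with hN
  let e : {ℓ // ℓ ∈ L} ≃ Fin N := L.equivFin
  let lab : Fin N → (Fin 3 → ℤ) × (Fin 4 → ℤ) := fun i => (e.symm i).1
  have hlab : ∀ i, lab i ∈ L := fun i => (e.symm i).2
  have hlab_inj : Function.Injective lab := fun i j h => e.symm.injective (Subtype.ext h)
  let H : Fin N → Finset (EuclideanSpace ℝ (Fin 3) × ℝ) := fun i => chamberH (lab i).1 (lab i).2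
  let Q : Fin N → Set (EuclideanSpace ℝ (Fin 3)) := fun i => cellOf (lab i).1 (lab i).2
  have hQ : ∀ i, Q i = ⋂ p ∈ H i, {x : EuclideanSpace ℝ (Fin 3) | ⟪p.1, x⟫ < p.2} := fun i => rfl
  have hbd : ∀ i, Bornology.IsBounded (Q i) := fun i => isBounded_cellOf _ _
  have hdisj : ∀ i j, i ≠ j → Disjoint (Q i) (Q j) := by
    intro i j hij
    refine disjoint_cellOf fun h => hij (hlab_inj ?_)
    exact Prod.ext (congrArg Prod.fst h) (congrArg Prod.snd h)
  -- affine data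
  choose g b hgb using fun i => exists_affine_tent X (lab i).1 (lab i).2
  have hf : ∀ i, ∀ x ∈ closure (Q i), tent X x = ⟪g i, x⟫ + b i :=
    fun i x hx => hgb i x (closure_cellOf_subset_closedChamber _ _ hx)
  have hcov : ∀ t : ℝ, 0 ≤ t → {x | t < tent X x} ⊆ ⋃ i, closure (Q i) := by
    intro t ht x hx
    obtain ⟨ℓ, hℓ, hxℓ⟩ := Set.mem_iUnion₂.1 (superlevel_subset_closure_cells X ht hx)
    refine Set.mem_iUnion.2 ⟨e ⟨ℓ, hℓ⟩, ?_⟩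
    have : lab (e ⟨ℓ, hℓ⟩) = ℓ := by simp [lab]
    show x ∈ closure (cellOf (lab (e ⟨ℓ, hℓ⟩)).1 (lab (e ⟨ℓ, hℓ⟩)).2)
    rw [this]; exact hxℓ
  -- the slab-0 cells meeting `U` with nonzero gradient, the majorant and its integral
  set S : Finset (Fin N) := Finset.univ.filter fun i => g i ≠ 0 ∧ (closure (Q i) ∩ U).Nonempty ∧ (lab i).2 0 = 0
    with hS
  have hSmem : ∀ i, g i ≠ 0 → (closure (Q i) ∩ U).Nonempty → (lab i).2 0 = 0 → i ∈ S :=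
    fun i h1 h2 h3 => Finset.mem_filter.2 ⟨Finset.mem_univ _, h1, h2, h3⟩
  let A : Fin N → ℝ → ℝ≥0∞ := fun i t => volume {x : EuclideanSpace ℝ (Fin 3) |
    ∃ y ∈ closure (Q i) ∩ {x | tent X x = t}, ∃ τ ∈ Set.Icc (0 : ℝ) 1, x = y + τ • (-(‖g i‖⁻¹ • g i))}
  let c : Fin N → ℝ := fun i =>
    sSup ((fun y : EuclideanSpace ℝ (Fin 3) => ⟪y, -(‖g i‖⁻¹ • g i)⟫) '' fccWulffBody)
  have hc0 : ∀ i, 0 ≤ c i := fun i => sSup_inner_nonneg isCompact_fccWulffBody zero_mem_fccWulffBody _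
  let F : ℝ → ℝ≥0∞ := fun t => ∑ i ∈ S, ENNReal.ofReal (c i) * A i t
  have hmeasA : ∀ i ∈ S, Measurable (fun t => ENNReal.ofReal (c i) * A i t) := fun i hi =>
    (measurable_volume_prism_levelFacet isClosed_closure.measurableSet (g i)
      (Finset.mem_filter.1 hi).2.1 (b i) (hf i)).const_mul _
  have hFm : Measurable F := Finset.measurable_sum _ hmeasA
  -- the total: `∫⁻_{t>0} F ≤ Σ_{i∈S} phiFcc(g i) |Q i| =: Ctot`
  set Ctot : ℝ := ∑ i ∈ S, phiFcc (g i) * (volume (Q i)).toReal with hCtot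
  have hCtot0 : 0 ≤ Ctot := Finset.sum_nonneg fun i _ => mul_nonneg (phiFcc_nonneg _) ENNReal.toReal_nonneg
  have hvolQ : ∀ i, volume (Q i) ≠ ⊤ := fun i => (hbd i).measure_lt_top.ne
  have hphi : ∀ gi : EuclideanSpace ℝ (Fin 3),
      sSup ((fun y : EuclideanSpace ℝ (Fin 3) => ⟪y, -gi⟫) '' fccWulffBody) = phiFcc gi := fun gi => by
    rw [(isGreatest_inner_fccWulffBody (-gi)).csSup_eq, phiFcc_neg]
  have hint : ∫⁻ t in Set.Ioi (0 : ℝ), F t ≤ ENNReal.ofReal Ctot := by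
    have h1 : ∫⁻ t in Set.Ioi (0 : ℝ), F t = ∑ i ∈ S, ENNReal.ofReal (c i) *
        (ENNReal.ofReal ‖g i‖ * volume (Q i ∩ {x | 0 < tent X x})) := by
      rw [lintegral_finsetSum _ hmeasA]
      refine Finset.sum_congr rfl fun i hi => ?_
      rw [lintegral_const_mul _ (measurable_volume_prism_levelFacet isClosed_closure.measurableSet (g i)
        (Finset.mem_filter.1 hi).2.1 (b i) (hf i)),
        lintegral_Ioi_volume_prism_levelFacet (convex_cellOf' _ _) (g i) (Finset.mem_filter.1 hi).2.1 (b i)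
          (hf i) 0]
    rw [h1, hCtot, ENNReal.ofReal_sum_of_nonneg fun i _ =>
      mul_nonneg (phiFcc_nonneg _) ENNReal.toReal_nonneg]
    refine Finset.sum_le_sum fun i hi => ?_
    have hgi : g i ≠ 0 := (Finset.mem_filter.1 hi).2.1
    rw [← mul_assoc, ← ENNReal.ofReal_mul (hc0 i), sSup_inner_image_neg_unit_mul_norm _ _ hgi,
      hphi, ENNReal.ofReal_mul (phiFcc_nonneg _), ENNReal.ofReal_toReal (hvolQ i)]
    gcongr
    exact Set.inter_subset_left
  -- bad levels (level plane = a facet plane, over ALL cells) are finitely many: force them to `⊤`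
  set Bad : Set ℝ := {t : ℝ | ∃ i, g i ≠ 0 ∧ ∃ p ∈ H i,
    {x : EuclideanSpace ℝ (Fin 3) | ⟪g i, x⟫ + b i = t} = {x | ⟪p.1, x⟫ = p.2}} with hBad
  have hBadf : Bad.Finite := finite_setOf_levelPlane_eq_facetPlane H g b
  let F' : ℝ → ℝ≥0∞ := fun t => if t ∈ Bad then ⊤ else F t
  have hF'm : Measurable F' := Measurable.ite hBadf.measurableSet measurable_const hFm
  have hF'F : F' =ᵐ[volume.restrict (Set.Ioo (0:ℝ) 1)] F := by
    have hnull : ∀ᵐ t ∂(volume.restrict (Set.Ioo (0:ℝ) 1)), t ∉ Bad :=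
      ae_restrict_of_ae (hBadf.countable.ae_notMem _)
    filter_upwards [hnull] with t ht
    simp [F', ht]
  have hint' : ∫⁻ t in Set.Ioo (0 : ℝ) 1, F' t ≤ ENNReal.ofReal Ctot := by
    rw [lintegral_congr_ae hF'F]
    exact le_trans (lintegral_mono_set Set.Ioo_subset_Ioi_self) hint
  -- the cost side: `Ctot ≤ ¼ #IP + ½ #IL` (level-independent)
  have hrep : ∀ i, ∃ r : Site × (Bool ⊕ (Fin 3 → Bool)), r.1 ∈ idx X ∧ labelOf r.1 r.2 = lab i := by
    intro i
    have := hlab i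
    rw [hL, labelsOf, Finset.mem_image] at this
    obtain ⟨r, hr, hrl⟩ := this
    exact ⟨r, (Finset.mem_product.1 hr).1, hrl⟩
  choose rep hrep1 hrep2 using hrep
  have hrep_inj : Set.InjOn rep ↑S := by
    intro i _ j _ h
    apply hlab_inj
    rw [← hrep2 i, ← hrep2 j, h]
  let meets : Site → (Bool ⊕ (Fin 3 → Bool)) → Prop := fun p κ =>
    (closedChamber (labelOf p κ).1 (labelOf p κ).2 ∩ U).Nonempty ∧ (labelOf p κ).2 0 = 0
  let costR : Site × (Bool ⊕ (Fin 3 → Bool)) → ℝ := fun r =>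
    Sum.elim (fun bb => if bb then (2 * eTetUp X r.1 : ℝ) else (2 * eTetDn X r.1 : ℝ))
      (fun s => (corner (patO X r.1) (octIdx 0 (s 0)) (octIdx 1 (s 1)) (octIdx 2 (s 2)) : ℝ)) r.2
  have hcostR0 : ∀ r, 0 ≤ costR r := by
    rintro ⟨p, κ⟩
    rcases κ with bb | s
    · have hu : (0 : ℤ) ≤ eTetUp X p := Finset.sum_nonneg fun i _ => Finset.sum_nonneg fun j _ => by
        split_ifs <;> norm_num
      have hd : (0 : ℤ) ≤ eTetDn X p := Finset.sum_nonneg fun i _ => Finset.sum_nonneg fun j _ => by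
        split_ifs <;> norm_num
      cases bb <;> simp [costR] <;> exact_mod_cast (by omega)
    · simp only [costR, Sum.elim_inr]; exact_mod_cast phiZ_nonneg _ _ _
  have hcell : ∀ i ∈ S, phiFcc (g i) * (volume (Q i)).toReal ≤ costR (rep i) / 24 := by
    intro i _
    have hQi : Q i = cellOf (labelOf (rep i).1 (rep i).2).1 (labelOf (rep i).1 (rep i).2).2 := by
      show cellOf (lab i).1 (lab i).2 = _; rw [hrep2 i]
    have hgbi : ∀ x ∈ closedChamber (labelOf (rep i).1 (rep i).2).1 (labelOf (rep i).1 (rep i).2).2,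
        tent X x = ⟪g i, x⟫ + b i := by rw [hrep2 i]; exact hgb i
    rw [hQi]
    generalize rep i = r at hgbi ⊢
    obtain ⟨p, κ⟩ := r
    rcases κ with bb | s
    · rcases Bool.eq_false_or_eq_true bb with hb | hb <;> subst hb
      · simp only [labelOf, Sum.elim_inl, if_true, costR] at hgbi ⊢
        exact cost_labelUp_le X p hgbi
      · simp only [labelOf, Sum.elim_inl, Bool.false_eq_true, if_false, costR] at hgbi ⊢
        exact cost_labelDn_le X p hgbi
    · simp only [labelOf, Sum.elim_inr, costR] at hgbi ⊢
      exact cost_labelCorner_le X p s hgbi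
  set R : Finset (Site × (Bool ⊕ (Fin 3 → Bool))) :=
    (idx X ×ˢ (Finset.univ : Finset (Bool ⊕ (Fin 3 → Bool)))).filter fun r => meets r.1 r.2 with hR
  have himg : S.image rep ⊆ R := by
    intro r hr
    obtain ⟨i, hi, rfl⟩ := Finset.mem_image.1 hr
    refine Finset.mem_filter.2 ⟨Finset.mem_product.2 ⟨hrep1 i, Finset.mem_univ _⟩, ?_, ?_⟩
    · obtain ⟨y, hy, hyU⟩ := (Finset.mem_filter.1 hi).2.2.1
      refine ⟨y, ?_, hyU⟩
      have := closure_cellOf_subset_closedChamber _ _ hy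
      rwa [← hrep2 i] at this
    · rw [hrep2 i]; exact (Finset.mem_filter.1 hi).2.2.2
  have hC1 : Ctot ≤ (∑ r ∈ R, costR r) / 24 := by
    calc Ctot ≤ ∑ i ∈ S, costR (rep i) / 24 := Finset.sum_le_sum hcell
      _ = (∑ i ∈ S, costR (rep i)) / 24 := by rw [Finset.sum_div]
      _ = (∑ r ∈ S.image rep, costR r) / 24 := by rw [Finset.sum_image hrep_inj]
      _ ≤ (∑ r ∈ R, costR r) / 24 := by
        have h := Finset.sum_le_sum_of_subset_of_nonneg himg fun r _ _ => hcostR0 r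
        linarith
  set Pup := (idx X).filter fun p => meets p (Sum.inl true) with hPup
  set Pdn := (idx X).filter fun p => meets p (Sum.inl false) with hPdn
  set PO := (idx X).filter fun p => ∃ s, meets p (Sum.inr s) with hPO
  have hC2 : (∑ r ∈ R, costR r) ≤ (tentCostOn24 X Pup Pdn PO : ℝ) :=
    sum_cost_le_tentCostOn24 X (idx X) meets
  have hC3 : (tentCostOn24 X Pup Pdn PO : ℝ) ≤
      6 * (((brokenNearIP X U).ncard : ℝ) + 2 * ((brokenNearIL X U).ncard : ℝ)) := by
    refine tentCostOn24_le_six_mul X U Pup Pdn PO ?_ ?_ ?_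
    · intro p hp
      obtain ⟨hne, hm⟩ := (Finset.mem_filter.1 hp).2
      exact ⟨by simpa [labelOf, labelUp, lay] using hm, by simpa [labelOf] using hne⟩
    · intro p hp
      obtain ⟨hne, hm⟩ := (Finset.mem_filter.1 hp).2
      refine ⟨?_, by simpa [labelOf] using hne⟩
      have : p 0 + p 1 + p 2 - 1 = 0 := by simpa [labelOf, labelDn] using hm
      simp only [lay]; omega
    · intro p hp
      obtain ⟨s, hne, hm⟩ := (Finset.mem_filter.1 hp).2
      exact ⟨by simpa [labelOf, labelCorner, lay] using hm, s, by simpa [labelOf] using hne⟩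
  have hCB : 4 * Ctot ≤ ((brokenNearIP X U).ncard : ℝ) + 2 * ((brokenNearIL X U).ncard : ℝ) := by linarith
  -- slab bookkeeping: a cell whose closure meets the open slab `0` has `m₀ = 0`
  have hslab : ∀ j, (closure (Q j) ∩ {x : EuclideanSpace ℝ (Fin 3) |
      0 < ⟪intVec (normal4 0), Real.sqrt 2 • x⟫ ∧ ⟪intVec (normal4 0), Real.sqrt 2 • x⟫ < 2}).Nonempty →
      (lab j).2 0 = 0 := by
    rintro j ⟨y, hy, hy1, hy2⟩
    exact label_zero_of_mem_closedChamber_of_slab (closure_cellOf_subset_closedChamber _ _ hy) hy1 hy2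
  -- THE LEVEL-INDEPENDENT DATA
  refine ⟨F', Ctot, hF'm, hCtot0, hCB, hint', ?_⟩
  -- now a level off the bad set
  intro t ht hF't
  have htBad : t ∉ Bad := by
    intro hmem
    exact hF't (by simp [F', hmem])
  have hF'eq : F' t = F t := by simp [F', htBad]
  have hgen : ∀ i, g i ≠ 0 → ∀ p ∈ H i,
      {x : EuclideanSpace ℝ (Fin 3) | ⟪g i, x⟫ + b i = t} ≠ {x | ⟪p.1, x⟫ = p.2} :=
    fun i hi p hp heq => htBad ⟨i, hi, p, hp, heq⟩
  -- finiteness of the prisms and the real form of `F t`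
  have hAfin : ∀ i, A i t ≠ ⊤ := by
    intro i
    refine volume_prism_ne_top_of_isBounded ((hbd i).closure.subset Set.inter_subset_left) _ ?_
    by_cases hgi : g i = 0
    · simp [hgi]
    · rw [norm_neg, norm_smul, norm_inv, norm_norm, inv_mul_cancel₀ (norm_ne_zero_iff.2 hgi)]
  have hterm : ∀ i, c i * (A i t).toReal = (ENNReal.ofReal (c i) * A i t).toReal := by
    intro i; rw [ENNReal.toReal_mul, ENNReal.toReal_ofReal (hc0 i)]
  have hFreal : ∑ i ∈ S, c i * (A i t).toReal = (F' t).toReal := by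
    rw [hF'eq, ENNReal.toReal_sum fun i _ => ENNReal.mul_ne_top ENNReal.ofReal_ne_top (hAfin i)]
    exact Finset.sum_congr rfl fun i _ => hterm i
  -- the polytope pieces (all cells), then keep the slab-0 ones and empty the others
  obtain ⟨Hd, hP1, hP2, hP3, hP4, hP5, hP6, hP7⟩ :=
    exists_polytope_pieces X lab hlab_inj g b hgb t hgen (hcov t ht.1.le)
  obtain ⟨hE1, hE2, hE3⟩ := emptyPiece_spec
  set E : Finset (EuclideanSpace ℝ (Fin 3) × ℝ) := {(EuclideanSpace.single (0 : Fin 3) (1 : ℝ), (0 : ℝ)),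
    (-EuclideanSpace.single (0 : Fin 3) (1 : ℝ), (-1 : ℝ))} with hEdef
  let Hd' : Fin N → Finset (EuclideanSpace ℝ (Fin 3) × ℝ) := fun j => if (lab j).2 0 = 0 then Hd j else E
  have hHd'0 : ∀ j, (lab j).2 0 = 0 → Hd' j = Hd j := fun j hj => by simp [Hd', hj]
  have hHd'1 : ∀ j, (lab j).2 0 ≠ 0 → polytope (Hd' j) = ∅ := fun j hj => by
    simp only [Hd', hj, if_false]; exact hE1
  have hsub' : ∀ j, polytope (Hd' j) ⊆ polytope (Hd j) := by
    intro j
    by_cases hj : (lab j).2 0 = 0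
    · rw [hHd'0 j hj]
    · rw [hHd'1 j hj]; exact Set.empty_subset _
  have hslab' : ∀ j, polytope (Hd' j) ⊆ {x : EuclideanSpace ℝ (Fin 3) |
      0 < ⟪intVec (normal4 0), Real.sqrt 2 • x⟫ ∧ ⟪intVec (normal4 0), Real.sqrt 2 • x⟫ < 2} := by
    intro j x hx
    by_cases hj : (lab j).2 0 = 0
    · rw [hHd'0 j hj] at hx
      have h := cellOf_subset_slab _ _ (hP5 j hx)
      simp only [hj, Int.cast_zero, mul_zero, zero_add, Set.mem_setOf_eq] at h
      exact h
    · rw [hHd'1 j hj] at hx; exact absurd hx (Set.notMem_empty x)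
  have hbd' : ∀ j, Bornology.IsBounded (polytope (Hd' j)) := fun j => (hP1 j).subset (hsub' j)
  have h2' : ∀ j, ∀ p ∈ Hd' j, ‖p.1‖ = 1 := by
    intro j p hp
    by_cases hj : (lab j).2 0 = 0
    · rw [hHd'0 j hj] at hp; exact hP2 j p hp
    · simp only [Hd', hj, if_false] at hp; exact hE2 p hp
  have h3' : ∀ j, ∀ p ∈ Hd' j, ∀ p' ∈ Hd' j, p ≠ p' →
      {x : EuclideanSpace ℝ (Fin 3) | ⟪p.1, x⟫ = p.2} ≠ {x | ⟪p'.1, x⟫ = p'.2} := by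
    intro j p hp p' hp' hne
    by_cases hj : (lab j).2 0 = 0
    · rw [hHd'0 j hj] at hp hp'; exact hP3 j p hp p' hp' hne
    · simp only [Hd', hj, if_false] at hp hp'; exact hE3 p hp p' hp' hne
  have h4' : ∀ j j', j ≠ j' → Disjoint (polytope (Hd' j)) (polytope (Hd' j')) :=
    fun j j' hjj => (hP4 j j' hjj).mono (hsub' j) (hsub' j')
  have hfin' : ∀ j, HasFinitePerimeter (polytope (Hd' j)) :=
    fun j => hasFinitePerimeter_polytope (Hd' j) (hbd' j) (h2' j) (h3' j)
  -- the super-level clauses of the slab-0 family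
  have hsup' : (⋃ j, polytope (Hd' j)) ⊆ {x | t < tent X x} := by
    intro x hx
    obtain ⟨j, hj⟩ := Set.mem_iUnion.1 hx
    exact hP6 (Set.mem_iUnion.2 ⟨j, hsub' j hj⟩)
  have hexh' : volume (({x | t < tent X x} ∩ {x : EuclideanSpace ℝ (Fin 3) |
      0 < ⟪intVec (normal4 0), Real.sqrt 2 • x⟫ ∧ ⟪intVec (normal4 0), Real.sqrt 2 • x⟫ < 2}) \
        ⋃ j, polytope (Hd' j)) = 0 := by
    refine measure_mono_null ?_ hP7
    rintro x ⟨⟨hxt, hx0, hx2⟩, hxG⟩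
    refine ⟨hxt, fun hmem => hxG ?_⟩
    obtain ⟨j, hj⟩ := Set.mem_iUnion.1 hmem
    have hj0 : (lab j).2 0 = 0 := hslab j ⟨x, subset_closure (hP5 j hj), hx0, hx2⟩
    exact Set.mem_iUnion.2 ⟨j, by rw [hHd'0 j hj0]; exact hj⟩
  refine ⟨N, Hd', hbd', h2', h3', h4', hslab', hfin', hsup', hexh', ?_, ?_, ?_⟩
  · -- within `√2` of the occupied sites
    intro x hx
    exact mem_balls_of_tent_pos X (lt_trans ht.1 (hsup' hx))
  · -- mass: slab-0 points with all bilayer sites within `√2` occupied lie in `{f_X > t}`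
    refine measure_mono_null ?_ hexh'
    rintro y ⟨⟨⟨hy0, hy2⟩, hy⟩, hyG⟩
    have hty : t < tent X y := by
      rw [tent_eq_one_of_forall_lay X hy0 hy2 fun a ha hd => hy a ha (by rw [dist_comm]; exact hd)]
      exact ht.2
    exact ⟨⟨hty, hy0, hy2⟩, hyG⟩
  · -- part V with the slab-0 cells at the level `t`
    intro ξ hξ hξc hξK hξU
    have hslabm : MeasurableSet {x : EuclideanSpace ℝ (Fin 3) |
        0 < ⟪intVec (normal4 0), Real.sqrt 2 • x⟫ ∧ ⟪intVec (normal4 0), Real.sqrt 2 • x⟫ < 2} := by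
      have hcn : Continuous fun x : EuclideanSpace ℝ (Fin 3) => ⟪intVec (normal4 0), Real.sqrt 2 • x⟫ :=
        continuous_const.inner (continuous_const_smul (Real.sqrt 2))
      exact ((isOpen_lt continuous_const hcn).inter (isOpen_lt hcn continuous_const)).measurableSet
    have hae : (⋃ j, polytope (Hd' j)) =ᵐ[volume]
        ({x | t < tent X x} ∩ {x | 0 < ⟪intVec (normal4 0), Real.sqrt 2 • x⟫ ∧
          ⟪intVec (normal4 0), Real.sqrt 2 • x⟫ < 2} : Set (EuclideanSpace ℝ (Fin 3))) := by
      refine (ae_eq_set).2 ⟨?_, hexh'⟩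
      refine measure_mono_null (fun x hx => ?_) measure_empty
      obtain ⟨hx1, hx2⟩ := hx
      exact hx2 ⟨hsup' hx1, by
        obtain ⟨j, hj⟩ := Set.mem_iUnion.1 hx1
        exact hslab' j hj⟩
    rw [setIntegral_congr_set hae,
      setIntegral_fieldDivergence_inter_eq hξ hξc hslabm (hξU.trans Set.inter_subset_right)]
    have hV := setIntegral_fieldDivergence_superlevel_le_localFacetSum H Q hQ hbd hdisj g b
      (continuous_tent X) hf isCompact_fccWulffBody zero_mem_fccWulffBody (hcov t ht.1.le) hgen hξ hξc hξK
      hξU S (fun j hj hne => hSmem j hj (hne.mono (Set.inter_subset_inter_right _ Set.inter_subset_left))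
        (hslab j (hne.mono (Set.inter_subset_inter_right _ Set.inter_subset_right))))
    rw [← hFreal]
    exact hV

end Summit.Ventures.Crystal3D.TentCertificate

end
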